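import Literature.NumberTheory.EllipticCurves.CanonicalPAdicHeightFirstOrderProofs
import Literature.NumberTheory.EllipticCurves.DivisionValuesSigmaFormulaProofs
import HarnessLib

/-!
# The first `3`-adic digit of the canonical `3`-adic height: `ĥ₃(P) ≡ ((num x(P))² - 1)/2 (mod 9)`

Sibling proof file of `CanonicalPAdicHeight.lean` / `CanonicalPAdicHeightFirstOrderProofs.lean` /
`DivisionValuesSigmaFormulaProofs.lean` (pure proofs: no definitions, no named facts). For a `ℤ`-integral
Weierstrass equation `W/ℚ` whose base change to `ℚ₃` has a Mazur–Tate pair (so that `σ₃` is the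
genuine sigma function: Mazur–Tate 1991 Thm. 3.1 / Mazur–Stein–Tate 2006 Thm. 1.3 "for `p` an odd
prime"; Balakrishnan 2016 §2 eq. (2.3) at `p = 3`) and a point `P = (x, y) ∈ E(ℚ) ∩ E₁(ℚ₃)`
(`‖x‖₃ > 1`), the cancellation theorem `‖ĥ₃(P) - log₃(num x)‖ ≤ ‖z(P)‖² ≤ 3⁻²`
(`CanonicalPAdicHeightFirstOrderProofs`) and the first-order logarithm of a unit
`log₃ u ≡ (u² - 1)/2 (mod 9)` (`norm_padicLog_sub_div_le`) give the FIRST DIGIT of `ĥ₃(P) ∈ 3ℤ₃` from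
`num x mod 9` alone:

* `norm_canonicalPAdicHeight_three_sub_le` — for any `d : ℤ` with `9 ∣ (num x)² - 1 - 6d`:
  **`‖ĥ₃(P) - 3d‖₃ ≤ 3⁻¹ ^ 2`** (so the digit of `ĥ₃(P)/3` is `0, 2, 1` according as
  `num x ≡ ±1, ±2, ±4 (mod 9)`); `norm_canonicalPAdicHeight_three_le` — **`‖ĥ₃(P)‖₃ ≤ 3⁻¹`** always;
* for THE canonical datum `D` (`PAdicHeightData.IsCanonical`) and `Q` admissible:
  `IsCanonical.norm_pairing_self_three_sub_le` (`‖⟨Q,Q⟩ - 3d‖ ≤ 3⁻¹ ^ 2`),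
  `IsCanonical.norm_pairing_self_three_div_sub_lt` (**`‖⟨Q,Q⟩/3 - d‖ < 1`**),
  `IsCanonical.norm_pairing_self_three_le` (**`‖⟨Q,Q⟩‖ ≤ 3⁻¹`**), and for any `Q ∈ E(ℚ) ∩ E₁(ℚ₃)`
  reducing non-singularly everywhere (e.g. a SUM of admissible points on a model with square-free
  discriminant) `IsCanonical.norm_pairing_self_three_le_of_mem_kernelOfReductionAt` — exactly the shapes
  `‖Dh.pairing Q Q / 3 - d‖ < 1`, `‖Dh.pairing Q Q‖ ≤ 3⁻¹` in which first-digit certificates for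
  `3`-adic regulators are consumed (`4N₁²N₂²·det Gram = 4AB - (C - A - B)²`; digits `d_A d_B ≡ 2 (mod 3)`
  and `C ∈ 3ℤ₃` force `det ≠ 0`);
* in DIVISION VALUES (`V/ℤ` with discriminant divisible by no prime square, integral point `P = (a,b)`,
  `n` with `3 ∣ ψₙ(P) ≠ 0`, the set-up of `DivisionValuesSigmaFormulaProofs`; `num x(nP) = φₙ(P)` by
  Ayad's lemma): `norm_pairing_zsmul_self_sub_padicLog_φ_le_sq` — at any `p ≥ 3` with a pair,
  **`‖⟨nP, nP⟩ - log_p φₙ(P)‖ ≤ ‖ψₙ(P)‖²`** (the second-order sharpening of the tree's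
  `norm_pairing_zsmul_self_sub_padicLog_φ_le`); at `p = 3`: `norm_pairing_zsmul_self_three_div_sub_lt`
  (**`9 ∣ φₙ(P)² - 1 - 6d ⇒ ‖⟨nP,nP⟩/3 - d‖ < 1`**) and `norm_pairing_zsmul_self_three_le`;
* `…_of_odd` — the pair hypothesis discharged by the named fact `mazur_tate_sigma_exists_odd`
  (`W` globally minimal, good ordinary at `3`); CONDITIONAL on that fact, whose only content beyond the
  tree theorem `mazur_tate_sigma_existsUnique_holds` (`p ≥ 5`) is `p = 3`
  (`mazur_tate_sigma_exists_odd_iff_three`).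

With the junk value `σ₃ = t` (no pair) the digit would shift by `a₁ z(P)`: the pair hypothesis is
essential at `p = 3`.

## References

* [Balakrishnan2016] J. S. Balakrishnan, *On 3-adic heights on elliptic curves*, J. Number Theory 161
  (2016), §2 eq. (2.3) and the display before (2.2).
* [MazurSteinTate2006] Doc. Math. Extra Vol. Coates (2006), §1 eq. (1.1), Thm. 1.3, Rem. 1.4, Alg. 3.4.
* [Harvey2008] LMS J. Comput. Math. 11 (2008), §5, Lemma 8 (`log_p u mod p^N` from `u mod p^N`).
* [Iwasawa1972PadicL] K. Iwasawa, *Lectures on `p`-adic `L`-functions*, §4.4.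

## Design

Hypotheses as in the sibling files (`[W.IsIntegral ℤ]`, `‖x‖₃ > 1`, plain pair hypothesis
`∃ σ c, (W.baseChange ℚ_[3]).IsMazurTateSigmaPair σ c`); the congruence input is the decidable
`(9 : ℤ) ∣ x.num ^ 2 - 1 - 6 * d` on Mathlib's lowest-terms numerator (resp. on `φₙ(P)`); errors
`3⁻¹ ^ 2`, `3⁻¹`, `< 1`.
-/

noncomputable section

open scoped Classical
open PowerSeries Literature.NumberTheory.EllipticCurves

namespace Literature.NumberTheory.EllipticCurves

variable {p : ℕ} [Fact p.Prime]

/-- `‖2‖_p = 1` for odd `p`. [folklore] -/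
private theorem norm_two_eq_one_of_ne_two (hp : p ≠ 2) : ‖(2 : ℚ_[p])‖ = 1 := by
  rw [show (2 : ℚ_[p]) = ((2 : ℕ) : ℚ_[p]) by norm_cast, Padic.norm_natCast_eq_one_iff]
  exact ((Nat.coprime_primes Nat.prime_two (Fact.out : p.Prime)).mpr (Ne.symm hp)).symm

/-- If `‖x‖_p > 1` for a rational `x`, its lowest-terms numerator is a `p`-adic unit (`p ∣ den x`,
`gcd(num, den) = 1`). [folklore] -/
private theorem norm_intCast_num_eq_one_of_one_lt_norm {x : ℚ} (hx : 1 < ‖(x : ℚ_[p])‖) :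
    ‖(x.num : ℚ_[p])‖ = 1 := by
  have hP : p.Prime := Fact.out
  refine le_antisymm (Padic.norm_int_le_one _) (not_lt.mp fun hlt => ?_)
  have hnum : p ∣ x.num.natAbs := Int.natCast_dvd.mp (Padic.norm_intCast_lt_one_iff.mp hlt)
  have hxnd : (x : ℚ_[p]) = (x.num : ℚ_[p]) / (x.den : ℚ_[p]) := by
    exact_mod_cast (Rat.num_div_den x).symm
  have hden_pos : 0 < ‖(x.den : ℚ_[p])‖ := norm_pos_iff.mpr (by exact_mod_cast x.den_nz)
  have hden1 : ‖(x.den : ℚ_[p])‖ < 1 := by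
    rw [hxnd, norm_div, lt_div_iff₀ hden_pos, one_mul] at hx
    exact hx.trans_le (Padic.norm_int_le_one _)
  have hden : p ∣ x.den := Padic.norm_natCast_lt_one_iff.mp hden1
  exact hP.one_lt.ne' ((Nat.Coprime.coprime_dvd_left hnum x.reduced).eq_one_of_dvd hden)

/-- **`log₃` of a `3`-adic unit to first order**: `‖log₃ u - (u² - 1)/2‖₃ ≤ 3⁻¹ ^ 2` and
`‖log₃ u‖₃ ≤ 3⁻¹` (`log₃ u = ½ log₃ u²`, `u² ∈ 1 + 3ℤ₃`; `norm_padicLog_sub_div_le` at `p = 3`).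
[Iwasawa 1972, §4.4; Harvey 2008, Lemma 8] [cite: Iwasawa1972PadicL, §4.4] -/
theorem norm_padicLog_three_sub_le_and_le {u : ℚ_[3]} (hu : ‖u‖ = 1) :
    ‖padicLog 3 u - (u ^ 2 - 1) / 2‖ ≤ 3⁻¹ ^ 2 ∧ ‖padicLog 3 u‖ ≤ 3⁻¹ := by
  have h32 : (3 : ℕ) ≠ 2 := by decide
  have h2 := norm_padicLog_sub_div_le (p := 3) h32 hu
  have h31 : ((3 : ℕ) : ℚ_[3]) - 1 = 2 := by norm_num
  rw [show (3 : ℕ) - 1 = 2 from rfl, h31] at h2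
  have hsq : ‖u ^ 2 - 1‖ ≤ 3⁻¹ := by
    have hlt : ‖1 - u ^ (3 - 1)‖ < 1 := norm_one_sub_pow_sub_one_lt (p := 3) hu
    rw [show (3 : ℕ) - 1 = 2 from rfl, norm_sub_rev] at hlt
    simpa using norm_le_inv_of_norm_lt_one hlt
  have h1 : ‖padicLog 3 u - (u ^ 2 - 1) / 2‖ ≤ 3⁻¹ ^ 2 :=
    h2.trans (pow_le_pow_left₀ (norm_nonneg _) hsq 2)
  refine ⟨h1, ?_⟩
  have hq : ‖(u ^ 2 - 1) / 2‖ ≤ 3⁻¹ := by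
    rw [norm_div, norm_two_eq_one_of_ne_two h32, div_one]; exact hsq
  have hsplit : padicLog 3 u = (padicLog 3 u - (u ^ 2 - 1) / 2) + (u ^ 2 - 1) / 2 := by ring
  rw [hsplit]
  refine (IsUltrametricDist.norm_add_le_max _ _).trans (max_le (h1.trans ?_) hq)
  norm_num

end Literature.NumberTheory.EllipticCurves

namespace WeierstrassCurve

/-! ### The digit of `ĥ₃(P)` -/

section Height

variable (W : WeierstrassCurve ℚ) [W.IsIntegral ℤ]

/-- **The first `3`-adic digit of `ĥ₃(P)` is read off `num x(P) mod 9`.** For a `ℤ`-integral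
equation whose base change to `ℚ₃` has a Mazur–Tate pair, `P = (x, y) ∈ E(ℚ)` with `‖x‖₃ > 1` and any
`d : ℤ` with `9 ∣ (num x)² - 1 - 6d`: `‖ĥ₃(P) - 3d‖₃ ≤ 3⁻²`. Indeed `ĥ₃(P) ≡ log₃(num x) (mod 9)`
(`…_num_le_sq`, `‖z(P)‖ ≤ 3⁻¹`), `log₃ u ≡ (u² - 1)/2 (mod 9)` for a `3`-adic unit and `num x` is a
unit. So the digit of `ĥ₃(P)/3` is `0, 2, 1` for `num x ≡ ±1, ±2, ±4 (mod 9)`.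
[Balakrishnan 2016, §2; Harvey 2008, §5 and Lemma 8] [cite: Harvey2008, §5 and Lemma 8] -/
theorem norm_canonicalPAdicHeight_three_sub_le
    (hσ : ∃ σ : ℚ_[3]⟦X⟧, ∃ c : ℚ_[3], (W.baseChange ℚ_[3]).IsMazurTateSigmaPair σ c)
    {x y : ℚ} (h : W.toAffine.Nonsingular x y) (hx : 1 < ‖(x : ℚ_[3])‖) (d : ℤ)
    (hd : (9 : ℤ) ∣ x.num ^ 2 - 1 - 6 * d) :
    ‖W.canonicalPAdicHeight 3 (.some x y h) - ((3 * d : ℤ) : ℚ_[3])‖ ≤ 3⁻¹ ^ 2 := by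
  have h32 : (3 : ℕ) ≠ 2 := by decide
  obtain ⟨-, -, ht, -⟩ := cast_ne_zero_of_one_lt_norm (p := 3) h hx
  have ht3 : ‖(x : ℚ_[3]) / y‖ ≤ 3⁻¹ := by simpa using norm_le_inv_of_norm_lt_one ht
  have n1 : ‖W.canonicalPAdicHeight 3 (.some x y h) - padicLog 3 (x.num : ℚ_[3])‖ ≤ 3⁻¹ ^ 2 :=
    (W.norm_canonicalPAdicHeight_sub_padicLog_num_le_sq h32 hσ h hx).trans
      (pow_le_pow_left₀ (norm_nonneg _) ht3 2)
  set φ : ℚ_[3] := (x.num : ℚ_[3]) with hφ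
  have n2 : ‖padicLog 3 φ - (φ ^ 2 - 1) / 2‖ ≤ 3⁻¹ ^ 2 :=
    (norm_padicLog_three_sub_le_and_le (norm_intCast_num_eq_one_of_one_lt_norm hx)).1
  have n3 : ‖(φ ^ 2 - 1) / 2 - ((3 * d : ℤ) : ℚ_[3])‖ ≤ 3⁻¹ ^ 2 := by
    have hd' : ((3 ^ 2 : ℕ) : ℤ) ∣ x.num ^ 2 - 1 - 6 * d := by norm_num; exact hd
    have hm : ‖((x.num ^ 2 - 1 - 6 * d : ℤ) : ℚ_[3])‖ ≤ 3⁻¹ ^ 2 := by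
      refine ((Padic.norm_int_le_pow_iff_dvd (p := 3) (x.num ^ 2 - 1 - 6 * d) 2).mpr hd').trans_eq ?_
      norm_num
    have hrew : (φ ^ 2 - 1) / 2 - ((3 * d : ℤ) : ℚ_[3]) =
        ((x.num ^ 2 - 1 - 6 * d : ℤ) : ℚ_[3]) / 2 := by
      rw [hφ]; push_cast; ring
    rw [hrew, norm_div, norm_two_eq_one_of_ne_two h32, div_one]
    exact hm
  have hsplit : W.canonicalPAdicHeight 3 (.some x y h) - ((3 * d : ℤ) : ℚ_[3]) =
      (W.canonicalPAdicHeight 3 (.some x y h) - padicLog 3 φ) + (padicLog 3 φ - (φ ^ 2 - 1) / 2)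
        + ((φ ^ 2 - 1) / 2 - ((3 * d : ℤ) : ℚ_[3])) := by ring
  rw [hsplit]
  refine (IsUltrametricDist.norm_add_le_max _ _).trans (max_le ?_ n3)
  exact (IsUltrametricDist.norm_add_le_max _ _).trans (max_le n1 n2)

/-- **`ĥ₃(P) ∈ 3ℤ₃`**: `‖ĥ₃(P)‖₃ ≤ 3⁻¹` for every `P = (x, y) ∈ E(ℚ)` with `‖x‖₃ > 1` (`ℤ`-integral
equation with a Mazur–Tate pair over `ℚ₃`): `ĥ₃(P) ≡ log₃(num x) (mod 9)` and `‖log₃ u‖ ≤ 3⁻¹` for a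
unit. [Balakrishnan 2016, §2; Harvey 2008, §5] [cite: Harvey2008, §5 and Lemma 8] -/
theorem norm_canonicalPAdicHeight_three_le
    (hσ : ∃ σ : ℚ_[3]⟦X⟧, ∃ c : ℚ_[3], (W.baseChange ℚ_[3]).IsMazurTateSigmaPair σ c)
    {x y : ℚ} (h : W.toAffine.Nonsingular x y) (hx : 1 < ‖(x : ℚ_[3])‖) :
    ‖W.canonicalPAdicHeight 3 (.some x y h)‖ ≤ 3⁻¹ := by
  have h32 : (3 : ℕ) ≠ 2 := by decide
  obtain ⟨-, -, ht, -⟩ := cast_ne_zero_of_one_lt_norm (p := 3) h hx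
  have ht3 : ‖(x : ℚ_[3]) / y‖ ≤ 3⁻¹ := by simpa using norm_le_inv_of_norm_lt_one ht
  have n1 : ‖W.canonicalPAdicHeight 3 (.some x y h) - padicLog 3 (x.num : ℚ_[3])‖ ≤ 3⁻¹ :=
    ((W.norm_canonicalPAdicHeight_sub_padicLog_num_le_sq h32 hσ h hx).trans
      (pow_le_pow_left₀ (norm_nonneg _) ht3 2)).trans (by norm_num)
  have n2 : ‖padicLog 3 (x.num : ℚ_[3])‖ ≤ 3⁻¹ :=
    (norm_padicLog_three_sub_le_and_le (norm_intCast_num_eq_one_of_one_lt_norm hx)).2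
  rw [← sub_add_cancel (W.canonicalPAdicHeight 3 (.some x y h)) (padicLog 3 (x.num : ℚ_[3]))]
  exact (IsUltrametricDist.norm_add_le_max _ _).trans (max_le n1 n2)

end Height

/-! ### For THE canonical datum -/

section Canonical

variable {W : WeierstrassCurve ℚ} [W.IsIntegral ℤ] {D : PAdicHeightData W 3}

/-- **For THE canonical `3`-adic datum, the first digit of `⟨Q, Q⟩`**: `D.IsCanonical`, `W`
`ℤ`-integral with a Mazur–Tate pair over `ℚ₃`, `Q = (x, y)` admissible and `9 ∣ (num x)² - 1 - 6d`
give `‖⟨Q, Q⟩_D - 3d‖₃ ≤ 3⁻¹ ^ 2`. [Balakrishnan 2016, §2; Harvey 2008, §5]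
[cite: Harvey2008, §5 and Lemma 8] -/
theorem PAdicHeightData.IsCanonical.norm_pairing_self_three_sub_le (hD : D.IsCanonical)
    (hσ : ∃ σ : ℚ_[3]⟦X⟧, ∃ c : ℚ_[3], (W.baseChange ℚ_[3]).IsMazurTateSigmaPair σ c)
    {x y : ℚ} {h : W.toAffine.Nonsingular x y} (hadm : W.IsAdmissible 3 (.some x y h)) (d : ℤ)
    (hd : (9 : ℤ) ∣ x.num ^ 2 - 1 - 6 * d) :
    ‖D.pairing (.some x y h) (.some x y h) - ((3 * d : ℤ) : ℚ_[3])‖ ≤ 3⁻¹ ^ 2 := by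
  rw [hD _ hadm]
  exact W.norm_canonicalPAdicHeight_three_sub_le hσ h hadm.2.1 d hd

/-- **Digit form `‖⟨Q, Q⟩/3 - d‖ < 1`** (same hypotheses): the shape consumed by the first-digit
regulator certificate. [Balakrishnan 2016, §2; Harvey 2008, §5] [cite: Harvey2008, §5 and Lemma 8] -/
theorem PAdicHeightData.IsCanonical.norm_pairing_self_three_div_sub_lt (hD : D.IsCanonical)
    (hσ : ∃ σ : ℚ_[3]⟦X⟧, ∃ c : ℚ_[3], (W.baseChange ℚ_[3]).IsMazurTateSigmaPair σ c)
    {x y : ℚ} {h : W.toAffine.Nonsingular x y} (hadm : W.IsAdmissible 3 (.some x y h)) (d : ℤ)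
    (hd : (9 : ℤ) ∣ x.num ^ 2 - 1 - 6 * d) :
    ‖D.pairing (.some x y h) (.some x y h) / 3 - (d : ℚ_[3])‖ < 1 := by
  have key := hD.norm_pairing_self_three_sub_le hσ hadm d hd
  have h3 : ‖(3 : ℚ_[3])‖ = 3⁻¹ := by simpa using Padic.norm_p (p := 3)
  have hrew : D.pairing (.some x y h) (.some x y h) / 3 - (d : ℚ_[3]) =
      (D.pairing (.some x y h) (.some x y h) - ((3 * d : ℤ) : ℚ_[3])) / 3 := by
    push_cast; ring
  rw [hrew, norm_div, h3, div_lt_one (by norm_num)]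
  exact key.trans_lt (by norm_num)

/-- **`⟨Q, Q⟩_D ∈ 3ℤ₃`** for THE canonical `3`-adic datum and every admissible `Q` (`ℤ`-integral `W`
with a Mazur–Tate pair over `ℚ₃`). [Balakrishnan 2016, §2; Harvey 2008, §5]
[cite: Harvey2008, §5 and Lemma 8] -/
theorem PAdicHeightData.IsCanonical.norm_pairing_self_three_le (hD : D.IsCanonical)
    (hσ : ∃ σ : ℚ_[3]⟦X⟧, ∃ c : ℚ_[3], (W.baseChange ℚ_[3]).IsMazurTateSigmaPair σ c)
    {x y : ℚ} {h : W.toAffine.Nonsingular x y} (hadm : W.IsAdmissible 3 (.some x y h)) :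
    ‖D.pairing (.some x y h) (.some x y h)‖ ≤ 3⁻¹ := by
  rw [hD _ hadm]
  exact W.norm_canonicalPAdicHeight_three_le hσ h hadm.2.1

/-- **`⟨Q, Q⟩_D ∈ 3ℤ₃` for every `Q ∈ E(ℚ) ∩ E₁(ℚ₃)` reducing non-singularly at every prime** (e.g.
a sum of such points on a model with square-free discriminant; `O` included): admissibility by
`isAdmissible_of_one_lt_norm`. [Mazur–Stein–Tate 2006, §1; Balakrishnan 2016, §2]
[cite: MazurSteinTate2006, §1] -/
theorem PAdicHeightData.IsCanonical.norm_pairing_self_three_le_of_mem_kernelOfReductionAt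
    (hD : D.IsCanonical)
    (hσ : ∃ σ : ℚ_[3]⟦X⟧, ∃ c : ℚ_[3], (W.baseChange ℚ_[3]).IsMazurTateSigmaPair σ c)
    {Q : W.toAffine.Point} (hQ : Q ∈ W.kernelOfReductionAt 3)
    (hred : ∀ ℓ : ℕ, ℓ.Prime → W.ReducesNonsingularlyAt ℓ Q) : ‖D.pairing Q Q‖ ≤ 3⁻¹ := by
  rcases Q with _ | ⟨x, y, h⟩
  · have h0 : D.pairing 0 0 = 0 := by simp
    change ‖D.pairing 0 0‖ ≤ _
    rw [h0, norm_zero]; positivity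
  · have hx : 1 < ‖(x : ℚ_[3])‖ := (some_mem_kernelOfReductionAt_iff h).mp hQ
    exact hD.norm_pairing_self_three_le hσ
      (W.isAdmissible_of_one_lt_norm le_rfl h hx fun ℓ hℓ => hred ℓ hℓ)

end Canonical

/-! ### In division values: `⟨nP, nP⟩` for an integral point `P` of a model `V/ℤ` -/

section DivisionValues

variable (V : WeierstrassCurve ℤ) {a b : ℤ} (p : ℕ) [Fact p.Prime]

/-- **Second-order form in division values: `‖⟨nP, nP⟩_D - log_p φₙ(P)‖_p ≤ ‖ψₙ(P)‖_p²`** for `V/ℤ`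
with discriminant divisible by no prime square, an integral point `P = (a, b)`, `p ≥ 3` with a
Mazur–Tate pair for `V ⊗ ℚ_p`, `n` with `p ∣ ψₙ(P) ≠ 0`, and THE canonical datum `D` (`num x(nP) = φₙ(P)`,
`‖z(nP)‖ = ‖ψₙ(P)‖` in `…_num_le_sq`); sharpens the tree's `norm_pairing_zsmul_self_sub_padicLog_φ_le`
(error `‖ψₙ(P)‖`) by one order. [Harvey 2008, §5; Mazur–Stein–Tate 2006, Alg. 3.4]
[cite: Harvey2008, §5 (evaluation of log_p(σ_p(mQ)/d(mQ)); Lemma 8)] -/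
theorem norm_pairing_zsmul_self_sub_padicLog_φ_le_sq (hp3 : 3 ≤ p)
    (hσ : ∃ σ : ℚ_[p]⟦X⟧, ∃ c : ℚ_[p],
      ((V.map (Int.castRingHom ℚ)).baseChange ℚ_[p]).IsMazurTateSigmaPair σ c)
    {D : PAdicHeightData (V.map (Int.castRingHom ℚ)) p} (hD : D.IsCanonical)
    (h : (V.map (Int.castRingHom ℚ)).toAffine.Nonsingular (a : ℚ) (b : ℚ))
    (hΔ : ∀ ℓ : ℕ, ℓ.Prime → ¬ (ℓ : ℤ) ^ 2 ∣ V.Δ) {n : ℤ}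
    (hψ : (V.ψ n).evalEval a b ≠ 0) (hp : (p : ℤ) ∣ (V.ψ n).evalEval a b) :
    ‖D.pairing (n • Affine.Point.some _ _ h) (n • Affine.Point.some _ _ h) -
        padicLog p (((V.φ n).evalEval a b : ℤ) : ℚ_[p])‖ ≤ ‖(((V.ψ n).evalEval a b : ℤ) : ℚ_[p])‖ ^ 2 := by
  haveI : (V.map (Int.castRingHom ℚ)).IsIntegral ℤ := ⟨V, rfl⟩
  have hp2 : p ≠ 2 := by omega
  have hn : n ≠ 0 := by rintro rfl; simp [ψ_zero] at hψ
  have hred : ∀ (ℓ : ℕ) [Fact ℓ.Prime], (V.map (Int.castRingHom ℚ)).HasNonsingularReductionAt ℓ a b :=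
    fun ℓ _ => V.hasNonsingularReductionAt_of_not_sq_dvd_Δ ℓ (hΔ ℓ Fact.out) h
  have hadm := V.isAdmissible_zsmul_of_dvd_ψ p hp3 h hΔ hψ hp
  obtain ⟨h₁, e⟩ := Affine.Point.zsmul_some_intCast_eq V h hψ
  rw [e] at hadm ⊢
  have key := hD.norm_pairing_self_sub_padicLog_num_le_sq hp2 hσ hadm
  rw [V.num_φ_div_ψ_sq_eq h hψ (fun ℓ _ _ => hred ℓ)] at key
  refine key.trans_eq ?_
  rw [← norm_neg, ← neg_div, V.padicParam_zsmul_eq p h (hred p) hψ hp,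
    V.norm_padicParam_zsmul_eq p h (hred p) hn hp]

/-- **The first `3`-adic digit of `⟨nP, nP⟩_D` from `φₙ(P) mod 9`** (same set-up at `p = 3`,
`3 ∣ ψₙ(P) ≠ 0`): `9 ∣ φₙ(P)² - 1 - 6d ⇒ ‖⟨nP, nP⟩_D/3 - d‖₃ < 1`.
[Balakrishnan 2016, §2; Mazur–Stein–Tate 2006, Alg. 3.4] [cite: Balakrishnan2016, §2 eq. (2.3)] -/
theorem norm_pairing_zsmul_self_three_div_sub_lt
    (hσ : ∃ σ : ℚ_[3]⟦X⟧, ∃ c : ℚ_[3],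
      ((V.map (Int.castRingHom ℚ)).baseChange ℚ_[3]).IsMazurTateSigmaPair σ c)
    {D : PAdicHeightData (V.map (Int.castRingHom ℚ)) 3} (hD : D.IsCanonical)
    (h : (V.map (Int.castRingHom ℚ)).toAffine.Nonsingular (a : ℚ) (b : ℚ))
    (hΔ : ∀ ℓ : ℕ, ℓ.Prime → ¬ (ℓ : ℤ) ^ 2 ∣ V.Δ) {n : ℤ}
    (hψ : (V.ψ n).evalEval a b ≠ 0) (h3 : (3 : ℤ) ∣ (V.ψ n).evalEval a b) (d : ℤ)
    (hd : (9 : ℤ) ∣ (V.φ n).evalEval a b ^ 2 - 1 - 6 * d) :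
    ‖D.pairing (n • Affine.Point.some _ _ h) (n • Affine.Point.some _ _ h) / 3 - (d : ℚ_[3])‖ < 1 := by
  haveI : (V.map (Int.castRingHom ℚ)).IsIntegral ℤ := ⟨V, rfl⟩
  have hred : ∀ (ℓ : ℕ) [Fact ℓ.Prime], (V.map (Int.castRingHom ℚ)).HasNonsingularReductionAt ℓ a b :=
    fun ℓ _ => V.hasNonsingularReductionAt_of_not_sq_dvd_Δ ℓ (hΔ ℓ Fact.out) h
  have hadm := V.isAdmissible_zsmul_of_dvd_ψ 3 le_rfl h hΔ hψ (by exact_mod_cast h3)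
  obtain ⟨h₁, e⟩ := Affine.Point.zsmul_some_intCast_eq V h hψ
  rw [e] at hadm ⊢
  refine hD.norm_pairing_self_three_div_sub_lt hσ hadm d ?_
  rwa [V.num_φ_div_ψ_sq_eq h hψ (fun ℓ _ _ => hred ℓ)]

/-- **`⟨nP, nP⟩_D ∈ 3ℤ₃`** in the same set-up (`3 ∣ ψₙ(P) ≠ 0`): `‖⟨nP, nP⟩_D‖₃ ≤ 3⁻¹`.
[Balakrishnan 2016, §2; Mazur–Stein–Tate 2006, Alg. 3.4] [cite: Balakrishnan2016, §2 eq. (2.3)] -/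
theorem norm_pairing_zsmul_self_three_le
    (hσ : ∃ σ : ℚ_[3]⟦X⟧, ∃ c : ℚ_[3],
      ((V.map (Int.castRingHom ℚ)).baseChange ℚ_[3]).IsMazurTateSigmaPair σ c)
    {D : PAdicHeightData (V.map (Int.castRingHom ℚ)) 3} (hD : D.IsCanonical)
    (h : (V.map (Int.castRingHom ℚ)).toAffine.Nonsingular (a : ℚ) (b : ℚ))
    (hΔ : ∀ ℓ : ℕ, ℓ.Prime → ¬ (ℓ : ℤ) ^ 2 ∣ V.Δ) {n : ℤ}
    (hψ : (V.ψ n).evalEval a b ≠ 0) (h3 : (3 : ℤ) ∣ (V.ψ n).evalEval a b) :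
    ‖D.pairing (n • Affine.Point.some _ _ h) (n • Affine.Point.some _ _ h)‖ ≤ 3⁻¹ := by
  haveI : (V.map (Int.castRingHom ℚ)).IsIntegral ℤ := ⟨V, rfl⟩
  have hadm := V.isAdmissible_zsmul_of_dvd_ψ 3 le_rfl h hΔ hψ (by exact_mod_cast h3)
  obtain ⟨h₁, e⟩ := Affine.Point.zsmul_some_intCast_eq V h hψ
  rw [e] at hadm ⊢
  exact hD.norm_pairing_self_three_le hσ hadm

end DivisionValues

/-! ### Under the sigma-existence fact at `p = 3` -/

section Facts

variable (W : WeierstrassCurve ℚ) [W.IsElliptic] [W.IsGloballyMinimal]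

/-- **First digit of THE canonical `3`-adic height under `mazur_tate_sigma_exists_odd`** (`W` globally
minimal, good ordinary at `3`): for the canonical datum `D`, an admissible `Q = (x, y)` and
`9 ∣ (num x)² - 1 - 6d`: `‖⟨Q, Q⟩_D/3 - d‖₃ < 1`, and `‖⟨Q, Q⟩_D‖₃ ≤ 3⁻¹`. CONDITIONAL on that fact.
[Balakrishnan 2016, §2 eq. (2.3)] [cite: Balakrishnan2016, §2 eq. (2.3)] -/
theorem PAdicHeightData.IsCanonical.norm_pairing_self_three_div_sub_lt_of_odd
    (hex : mazur_tate_sigma_exists_odd)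
    (hgood : W.HasGoodReductionAtPrime 3) (hord : ¬ ((3 : ℕ) : ℤ) ∣ W.frobeniusTrace 3)
    {D : PAdicHeightData W 3} (hD : D.IsCanonical)
    {x y : ℚ} {h : W.toAffine.Nonsingular x y} (hadm : W.IsAdmissible 3 (.some x y h)) (d : ℤ)
    (hd : (9 : ℤ) ∣ x.num ^ 2 - 1 - 6 * d) :
    ‖D.pairing (.some x y h) (.some x y h) / 3 - (d : ℚ_[3])‖ < 1 ∧
      ‖D.pairing (.some x y h) (.some x y h)‖ ≤ 3⁻¹ :=
  ⟨hD.norm_pairing_self_three_div_sub_lt (hex W 3 (by decide) hgood hord) hadm d hd,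
    hD.norm_pairing_self_three_le (hex W 3 (by decide) hgood hord) hadm⟩

end Facts

end WeierstrassCurve

end
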